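import Summits.CriticalPhenomena.PercolationContinuityZ3.Theorems.PercNearOneGluingNoHeavyConstsChernoffLeafIneq
import HarnessLib

/-!
# The star case of (LT³⁄₂), leaf-observer core: `P(#closed relay edges ≥ t⁺) ≤ x(2 − 3x/2)/(1 − x)` at the sharpened threshold

builds on p205010 (kernel theorem, internal audit signed; external expert review pending)

PAPER-2 track "percolation constants", part (ii), seat `prim-consts-1`, gen 9 (lane index `run/shared/lean/prim/consts/CONSTANTS.md`,
row A19; memo `FROM-prim-consts-1-g8-ROOTED-SPLIT.md` §6b step (v')).  Support file for the crux `NoHeavyLowerTail`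
(stmt-CriticalPhenomena-4575; `--supports … --as helper`): theorems only, no definitions, no sorries, standard axioms.  Companion of
`…ConstsChernoffStar` (`Consts.prodBernoulli_real_closedCount_ge_le_star`, centre observer) and of `…ConstsChernoffLeafIneq` (the
two-integer inequality `Consts.leaf_ineq` used here).

* `Consts.chernoff_ld_at_leaf_threshold` — at `y = (3t − K − 1)/(2K)`, `K = t + m`, the large-deviation bound
  `(K/t)^t (K/m)^m y^t (1−y)^m` equals `((3t−K−1)/(2t))^t ((3m+1)/(2m))^m` (algebra).
* `Consts.prodBernoulli_real_closedCount_ge_le_leaf` — **LEAF-OBSERVER CORE**: `F` a finite set of `K ≥ 5` coordinates under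
  `prodBernoulli p`, `x = (Σ_{i∈F}(1 − p_i))/K` with `0 < x`, `2x − x² < 2/3`, and `t` the least integer `> K/3 + 2xK/3 + 1/3`
  (hypotheses `K/3 + 2xK/3 + 1/3 < t ≤ K/3 + 2xK/3 + 4/3`).  Then `P(t ≤ #{i ∈ F : i closed}) ≤ x(2 − 3x/2)/(1 − x)`.
  Chain: `B(K,t,x) = C·x^{t−1}(1−x)^{m+1}·x/(1−x) ≤ C·y^{t−1}(1−y)^{m+1}·x/(1−x)` (`Consts.pow_mul_pow_le_of_le`, needs `yK ≤ t − 1`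
  i.e. `t ≤ K − 1`) `= B(K,t,y)·(1−y)/y·x/(1−x) ≤ G(y)(1−y)/y·x/(1−x) = (2 − 3y/2)·x/(1−x) ≤ (2 − 3x/2)·x/(1−x) = G(x)`.
On a star whose observer is a relay leaf `ℓ` this gives `P(1 ≤ N < (2/3)·EN) ≤ q_ℓ + (1 − q_ℓ)G(x) ≤ (3/2)·s`; the graph wrapper
(all stars, all observers) is `…ConstsLinearLowerTailStar`.
References: G. Grimmett, *Percolation* (1999), §2.2; W. Hoeffding, J. Amer. Statist. Assoc. 58 (1963) 13–30.
-/

noncomputable section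

namespace Summit.CriticalPhenomena.PercolationContinuityZ3.Theorems

open MeasureTheory Set Literature.Probability.LatticeModels Literature.Probability.Percolation
open scoped Classical

namespace Consts

/-- **The sharpened star threshold makes the bound explicit**: at `y = (3t − K − 1)/(2K)` with `K = t + m`, the large-deviation bound
`((t+m)/t)^t ((t+m)/m)^m y^t (1−y)^m` equals `((3t−K−1)/(2t))^t · ((3m+1)/(2m))^m` (pure algebra). [folklore] -/
theorem chernoff_ld_at_leaf_threshold {t m : ℕ} (ht : 0 < t) (hm : 0 < m) :
    (((t : ℝ) + m) / t) ^ t * (((t : ℝ) + m) / m) ^ m * ((3 * t - (t + m) - 1) / (2 * (t + m))) ^ t *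
        (1 - (3 * t - (t + m) - 1) / (2 * (t + m))) ^ m =
      ((3 * t - ((t : ℝ) + m) - 1) / (2 * t)) ^ t * ((3 * (m : ℝ) + 1) / (2 * m)) ^ m := by
  have htR : (0 : ℝ) < t := by exact_mod_cast ht
  have hmR : (0 : ℝ) < m := by exact_mod_cast hm
  have hK : (0 : ℝ) < t + m := by linarith
  have h1 : 1 - (3 * t - ((t : ℝ) + m) - 1) / (2 * (t + m)) = (3 * m + 1) / (2 * (t + m)) := by
    field_simp
    ring
  have ht0 : (t : ℝ) ^ t ≠ 0 := pow_ne_zero _ htR.ne'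
  have hm0 : (m : ℝ) ^ m ≠ 0 := pow_ne_zero _ hmR.ne'
  have hK0 : (2 * ((t : ℝ) + m)) ^ t ≠ 0 := pow_ne_zero _ (by positivity)
  have hK1 : (2 * ((t : ℝ) + m)) ^ m ≠ 0 := pow_ne_zero _ (by positivity)
  have h2t : (2 * (t : ℝ)) ^ t ≠ 0 := pow_ne_zero _ (by positivity)
  have h2m : (2 * (m : ℝ)) ^ m ≠ 0 := pow_ne_zero _ (by positivity)
  rw [h1]
  simp only [div_pow, mul_pow]
  field_simp

variable {ι : Type*} [Finite ι]

/-- **The star case of (LT³⁄₂), leaf-observer core.**  `F` a finite set of `K ≥ 5` coordinates, `x` the mean closing probability,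
`0 < x`, `2x − x² < 2/3`, and `t` the least integer exceeding `K/3 + 2xK/3 + 1/3`.  Then
`P(t ≤ #{i ∈ F : i closed}) ≤ x(2 − 3x/2)/(1 − x)`. [folklore] -/
theorem prodBernoulli_real_closedCount_ge_le_leaf (p : ι → unitInterval) (F : Finset ι) (h5 : 5 ≤ F.card)
    {x : ℝ} (hxdef : x = (∑ i ∈ F, (1 - (p i : ℝ))) / F.card) (hx0 : 0 < x) (hx2 : 2 * x - x ^ 2 < 2 / 3)
    {t : ℕ} (ht1 : (F.card : ℝ) / 3 + 2 * x * F.card / 3 + 1 / 3 < t)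
    (ht2 : (t : ℝ) ≤ F.card / 3 + 2 * x * F.card / 3 + 4 / 3) :
    (prodBernoulli p).real {ω : Set ι | t ≤ (F.filter fun i => i ∉ ω).card} ≤ x * (2 - 3 * x / 2) / (1 - x) := by
  set K : ℕ := F.card with hKdef
  have hK0 : (0 : ℝ) < K := by exact_mod_cast (show 0 < K by omega)
  have hK5 : (5 : ℝ) ≤ K := by exact_mod_cast h5
  -- x ≤ 1 (mean of numbers in [0,1]) hence x < 0.4227
  have hx1 : x ≤ 1 := by
    rw [hxdef, div_le_one hK0]
    calc ∑ i ∈ F, (1 - (p i : ℝ)) ≤ ∑ i ∈ F, (1 : ℝ) := Finset.sum_le_sum fun i _ => by linarith [(p i).2.1]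
      _ = K := by simp [hKdef]
  have hxs : x < 4227 / 10000 := by
    by_contra h
    push Not at h
    nlinarith
  have ht3 : K + 2 ≤ 3 * t := by
    have h : (K : ℝ) + 1 < 3 * t := by nlinarith
    have h' : ((K + 1 : ℕ) : ℝ) < ((3 * t : ℕ) : ℝ) := by push_cast; exact h
    have h'' : K + 1 < 3 * t := by exact_mod_cast h'
    omega
  have htK : t + 1 ≤ K := by
    by_contra h
    have hKt : (K : ℝ) ≤ t := by exact_mod_cast (show K ≤ t by omega)
    nlinarith
  have ht2' : 2 ≤ t := by omega
  set m : ℕ := K - t with hm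
  have hm1 : 0 < m := by omega
  have hKtm : K = t + m := by omega
  have hmean : x * ((t : ℝ) + m) ≤ t := by
    have : ((t : ℝ) + m) = K := by rw [hKtm]; push_cast; ring
    rw [this]; nlinarith
  have hld := prodBernoulli_real_closedCount_ge_le_ld p F (by omega) hm1 hKtm hxdef hx0 (by linarith) hmean
  set y : ℝ := ((3 * t - K - 1 : ℕ) : ℝ) / (2 * K) with hy
  have hcast : ((3 * t - K - 1 : ℕ) : ℝ) = 3 * (t : ℝ) - K - 1 := by
    have h : (3 * t - K - 1 : ℕ) + K + 1 = 3 * t := by omega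
    have h' : (((3 * t - K - 1 : ℕ) + K + 1 : ℕ) : ℝ) = ((3 * t : ℕ) : ℝ) := by rw [h]
    push_cast at h'
    linarith
  have hy0 : 0 < y := by
    rw [hy, hcast]
    apply div_pos _ (by linarith)
    have : ((K + 2 : ℕ) : ℝ) ≤ ((3 * t : ℕ) : ℝ) := by exact_mod_cast ht3
    push_cast at this
    linarith
  have hy1 : y < 1 := by
    rw [hy, hcast, div_lt_one (by linarith)]
    have : (t : ℝ) + 1 ≤ K := by exact_mod_cast htK
    linarith
  have hxy : x ≤ y := by
    rw [hy, hcast, le_div_iff₀ (by linarith)]; linarith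
  -- monotonicity of x^(t-1) (1-x)^(m+1) up to y (needs y K ≤ t - 1, i.e. t ≤ K - 1)
  have hyt : y * (((t - 1 : ℕ) : ℝ) + ((m + 1 : ℕ) : ℝ)) ≤ ((t - 1 : ℕ) : ℝ) := by
    have htc : ((t - 1 : ℕ) : ℝ) = (t : ℝ) - 1 := by rw [Nat.cast_sub (by omega)]; push_cast; ring
    have hmc : (m : ℝ) = K - t := by rw [hm, Nat.cast_sub (by omega)]
    have hsum : ((t - 1 : ℕ) : ℝ) + ((m + 1 : ℕ) : ℝ) = K := by push_cast [htc, hmc]; ring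
    rw [hsum, htc, hy, hcast, div_mul_eq_mul_div, div_le_iff₀ (by linarith)]
    have htK' : (t : ℝ) + 1 ≤ K := by exact_mod_cast htK
    nlinarith
  have hmono := pow_mul_pow_le_of_le (a := t - 1) (b := m + 1) (by omega) hx0.le hxy hy1 hyt
  -- the two-integer inequality at y (K ≤ 100: all t; K > 100: range 3t - K - 1 ≤ 2xK + 3 < 0.85 K + 3 ≤ 0.9 K)
  have hleaf : (((3 * t - K - 1 : ℕ) : ℝ) / (2 * t)) ^ t * ((3 * ((K - t : ℕ) : ℝ) + 1) / (2 * ((K - t : ℕ) : ℝ))) ^ (K - t) ≤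
      ((3 * t - K - 1 : ℕ) : ℝ) / (2 * K) * (2 - 3 * (((3 * t - K - 1 : ℕ) : ℝ) / (2 * K)) / 2) /
        (1 - ((3 * t - K - 1 : ℕ) : ℝ) / (2 * K)) := by
    by_cases hK100 : K ≤ 100
    · exact leaf_ineq_small K t h5 hK100 ht3 (by omega)
    · refine leaf_ineq K t h5 ht3 htK ?_
      have hK100' : (100 : ℝ) < K := by exact_mod_cast (show 100 < K by omega)
      have hr : (10 : ℝ) * ((3 * t - K - 1 : ℕ) : ℝ) ≤ 9 * K := by rw [hcast]; nlinarith
      exact_mod_cast hr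
  have hF := chernoff_ld_at_leaf_threshold (t := t) (m := m) (by omega) hm1
  have hKR : ((t : ℝ) + m) = K := by rw [hKtm]; push_cast; ring
  have hyK : y = (3 * (t : ℝ) - (t + m) - 1) / (2 * (t + m)) := by rw [hy, hcast, hKR]
  have hmK : ((K - t : ℕ) : ℝ) = m := by rw [hm]
  -- B(y) := C y^t (1-y)^m ≤ G(y)
  set C : ℝ := (((t : ℝ) + m) / t) ^ t * (((t : ℝ) + m) / m) ^ m with hC
  have hC0 : 0 ≤ C := by positivity
  have hBy : C * y ^ t * (1 - y) ^ m ≤ y * (2 - 3 * y / 2) / (1 - y) := by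
    have e1 : C * y ^ t * (1 - y) ^ m = (((3 * t - K - 1 : ℕ) : ℝ) / (2 * t)) ^ t *
        ((3 * ((K - t : ℕ) : ℝ) + 1) / (2 * ((K - t : ℕ) : ℝ))) ^ (K - t) := by
      rw [hC, hyK, hF, hcast, hKR, hmK, ← hm]
    rw [e1]
    exact hleaf
  -- chain: B(x) = C x^(t-1)(1-x)^(m+1) · x/(1-x) ≤ C y^(t-1)(1-y)^(m+1) · x/(1-x) = B(y) (1-y)/y · x/(1-x)
  --        ≤ G(y)(1-y)/y · x/(1-x) = (2 - 3y/2) x/(1-x) ≤ (2 - 3x/2) x/(1-x)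
  have h1x : 0 < 1 - x := by linarith
  have h1y : 0 < 1 - y := by linarith
  have ht1' : t = (t - 1) + 1 := by omega
  have eBx : C * x ^ t * (1 - x) ^ m = C * (x ^ (t - 1) * (1 - x) ^ (m + 1)) * (x / (1 - x)) := by
    rw [ht1', pow_succ, Nat.add_sub_cancel, pow_succ]
    field_simp
  have eBy : C * (y ^ (t - 1) * (1 - y) ^ (m + 1)) = (C * y ^ t * (1 - y) ^ m) * ((1 - y) / y) := by
    rw [← pow_sub_one_mul (show t ≠ 0 by omega) y, pow_succ]
    field_simp
  have hxx : 0 ≤ x / (1 - x) := div_nonneg hx0.le h1x.le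
  calc (prodBernoulli p).real {ω : Set ι | t ≤ (F.filter fun i => i ∉ ω).card}
      ≤ C * x ^ t * (1 - x) ^ m := hld
    _ = C * (x ^ (t - 1) * (1 - x) ^ (m + 1)) * (x / (1 - x)) := eBx
    _ ≤ C * (y ^ (t - 1) * (1 - y) ^ (m + 1)) * (x / (1 - x)) :=
        mul_le_mul_of_nonneg_right (mul_le_mul_of_nonneg_left hmono hC0) hxx
    _ = (C * y ^ t * (1 - y) ^ m) * ((1 - y) / y) * (x / (1 - x)) := by rw [eBy]
    _ ≤ (y * (2 - 3 * y / 2) / (1 - y)) * ((1 - y) / y) * (x / (1 - x)) :=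
        mul_le_mul_of_nonneg_right (mul_le_mul_of_nonneg_right hBy (div_nonneg h1y.le hy0.le)) hxx
    _ = (2 - 3 * y / 2) * (x / (1 - x)) := by
        field_simp
    _ ≤ (2 - 3 * x / 2) * (x / (1 - x)) := mul_le_mul_of_nonneg_right (by linarith) hxx
    _ = x * (2 - 3 * x / 2) / (1 - x) := by
        field_simp

end Consts

end Summit.CriticalPhenomena.PercolationContinuityZ3.Theorems
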